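import Literature.Barriers.QuantumAdvantage.AaronsonChenOracle
import Literature.Computability.Complexity.AverageCaseDepthHierarchy
import Literature.Computability.Complexity.PRelHierarchy
import Literature.Computability.Complexity.OracleBPP
import Literature.Computability.QuantumComplexity.OracleSeparationBQPPH
import HarnessLib

/-!
# `PH^{TQBF ⊕ O}` is infinite for `O ∼ 𝒟_O` (Aaronson–Chen 2017, Thm. 5.1, second half): the decomposition

Support file for the named fact `aaronsonChen2017_thm51_ph` of `AaronsonChenOracle.lean`
(S. Aaronson, L. Chen, CCC 2017, arXiv:1612.05903 [AaronsonChen2017], **Thm. 5.1** second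
statement, p. 21: "For an oracle `O` drawn from the distribution `𝒟_O` … `PH^{TQBF,O}` is
infinite" with probability `1`), whose printed proof (§5.4, p. 24) is: **Thm. 5.4** = the
Rossman–Servedio–Tan average-case depth hierarchy theorem (the tree's
`rossmanServedioTan2015_thm1`, `AverageCaseDepthHierarchy.lean`); **Lemma 5.5**: the composed
function `Sipser_d ∘ OR` on `{0,1}^{N²}` is hard on average for depth-`(d-1)` size-`2^{N^{1/(6(d-1))}}`
circuits when the inputs are drawn from `𝒟_n` (averaging over the hidden positions plus a
projection); and "it is easy to see that [`Sipser_d ∘ OR`] has a polynomial-size circuit (in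
fact, a formula) of depth `d + 1` … So it follows from the standard connection between `PH` and
`AC⁰` [Furst–Saxe–Sipser] that `PH^O` is infinite with probability `1` when `O ∼ 𝒟_O`."

This file fixes the DIAGONAL LANGUAGES of that standard connection and reduces
`aaronsonChen2017_thm51_ph`, by proof, to one upper-bound fact and one almost-sure lower-bound
fact about them:

* `blockOr B ℓ i` — the hidden bit `g(p) = ⋁_{x ∈ B_{ℓ,p}} O(x)` of the block of prefix
  `p = natBits ℓ i` at level `ℓ`, read through the joined oracle `B` (`O(x) = [1x ∈ B]`, so that
  for `B = A ⊕ O` it is the block-OR of `O`, `blockOr_oracleJoin_iff`) (§5.2 p. 20);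
* `sipserOrLang d B` — the level-`|x|` instance of `Sipser_d ∘ OR` (Lemma 5.5) as a language:
  `x` carries, in binary, a fan-in sequence `ws` of length `d` (`x = ⟨encode ws, padding⟩`), and
  `x ∈ sipserOrLang d B` iff the read-once alternating formula with fan-ins `ws`
  (`sipserEval`, root `∨` iff `d` even) on the block-ORs `blockOr B |x| (addrIndex ws a)` of the
  `∏ ws ≤ 2^{|x|}` blocks it addresses is true. Reading the fan-ins off the input keeps the
  `Σ`-machine free of RST's real-number parameters (`w₀` is defined by a real inequality); the
  lower bound only looks at inputs carrying RST's own fan-ins `rstFanins m d`;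
* `sipserOrLang_mem_PHRel` — named fact (the routine half of the standard connection, "clearly
  `L_A ∈ Σₖ^P(A)`", Ko 1989 §4.2; "a formula of depth `d + 1`", AC17 p. 24): `sipserOrLang d B ∈ PH^B`;
* `sipserOrLang_ae_not_mem_sigmaPRel` — named fact recording the CONTENT of §5.4 in the tree's
  models: for every `k` and every fixed left oracle `A`, for `𝒟_O`-almost every `O`,
  `sipserOrLang (k+3) (A ⊕ O) ∉ Σₖ^{A ⊕ O}` (a `Σₖ^{A ⊕ O}` predicate at a fixed input is a
  depth-`(k+2)` circuit of size `2^{poly}` in the level window — the tree's PROVED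
  `FSS84_phWindowCircuits` — and Lemma 5.5 with `d = k + 3` defeats it on infinitely many sparse
  levels with conditional probability `≤ 1/2 + o(1)` each; countably many predicates). Its
  discharge from `rossmanServedioTan2015_thm1` (+ the `w₀` estimate) is the job of the sibling
  lower-bound files; `TQBF` plays no role in this half, hence the general `A`;
* PROVED: `SigmaPRel_subset_succ` (`Σₖ^O ⊆ Σₖ₊₁^O`, from the tree theorems `compl_mem_PRel`,
  `PRel_closed_boolUnpair_fst`), `isInfinitePHRel_of_forall_exists` (if every level misses some
  `PH^O` language then no two consecutive levels coincide — the upward collapse is definitional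
  for the iterated-operator hierarchy `sigmaP`), `ae_isInfinitePHRel_oracleJoin` (for every `A`,
  a.s. `PH^{A ⊕ O}` is infinite) and `aaronsonChen2017_thm51_ph_of_parts`; with the reductions
  of `AaronsonChenOracle.lean`, `aaronsonChen2017_cor52_of_parts'`.

## Sources

* [AaronsonChen2017] arXiv:1612.05903, `lit read` pp. 20–24: §5.2 (blocks `B_{n,p}`, `g(p)`),
  Thm. 5.1 / Cor. 5.2 (p. 21), §5.4 p. 24 (Thm. 5.4, Lemma 5.5, proof of the second part).
* [Ko1989] K.-I Ko, *Constructing oracles by lower bound techniques for circuits* (1989),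
  `lit read doi:10.1007/978-94-009-2411-6_2` p. 15, §4.2: "It is sufficient to find, for each
  `k > 0`, a set `L_A ∈ Σₖ^P(A)` such that `L_A ∉ Πₖ^P(A)` … Then, clearly, `L_A ∈ Σₖ^P(A)`."
* [FurstSaxeSipser1984] the `PH ↦ AC⁰` connection, as made precise by Ko's Lemmas 2.1/2.3 and
  PROVED in the tree as `fSS84_phWindowCircuits_holds` (`OracleSeparationBQPPHProofs.lean`).
* [RossmanServedioTan2015] Thm. 1 and §2.3 (Thm. 2 "via Chapter 7 of Håstad's thesis").
-/

noncomputable section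

namespace Literature.Barriers.QuantumAdvantage

open MeasureTheory _root_.Computability
  Literature.Computability.Complexity.Classes Literature.Computability.QuantumComplexity
open Literature.Computability.Complexity hiding natBits length_natBits

/-! ### `Σₖ^O ⊆ Σₖ₊₁^O` and the collapse reading of "`PH^O` is infinite" -/

/-- `P^O ⊆ Σ₁^O = ∃ᵖ·co P^O`: a dummy witness of length `0`, the verifier reading the first
component (`P^O` is closed under complement and under `z ↦ (boolUnpair z).1`-preimages).
[cite: Stockmeyer1976, §3] -/
theorem PRel_subset_polyExists_co (O : Oracle) : PRel O ⊆ polyExists (co (PRel O)) := by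
  intro L hL
  refine ⟨{z | (boolUnpair z).1 ∈ L}, ?_, 0, fun x => ?_⟩
  · show {z | (boolUnpair z).1 ∈ L}ᶜ ∈ PRel O
    exact PRel_closed_boolUnpair_fst O (compl_mem_PRel hL)
  · constructor
    · intro hx
      refine ⟨[], by simp, ?_⟩
      change (boolUnpair (boolPair x [])).1 ∈ L
      rwa [boolUnpair_boolPair]
    · rintro ⟨y, -, hy⟩
      change (boolUnpair (boolPair x y)).1 ∈ L at hy
      rwa [boolUnpair_boolPair] at hy

/-- **`Σₖ^O ⊆ Σₖ₊₁^O`** for the relativized hierarchy of `PolyHierarchy.lean` (by induction: the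
base is `PRel_subset_polyExists_co`, the step is monotonicity of `∃ᵖ·co`). [cite: Stockmeyer1976, §3] -/
theorem SigmaPRel_subset_succ (O : Oracle) : ∀ k : ℕ, SigmaPRel O k ⊆ SigmaPRel O (k + 1)
  | 0 => PRel_subset_polyExists_co O
  | k + 1 => polyExists_mono (co_mono (SigmaPRel_subset_succ O k))

/-- `Σⱼ^O ⊆ Σₖ^O` for `j ≤ k`. [cite: Stockmeyer1976, §3] -/
theorem SigmaPRel_mono (O : Oracle) {j k : ℕ} (h : j ≤ k) : SigmaPRel O j ⊆ SigmaPRel O k := by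
  induction h with
  | refl => exact subset_rfl
  | step _ ih => exact ih.trans (SigmaPRel_subset_succ O _)

/-- If two consecutive levels coincide, the hierarchy is constant from there on (definitional
upward collapse of the iterated operator `Σⱼ₊₁ = ∃ᵖ·co Σⱼ`). [cite: Stockmeyer1976, §3] -/
theorem SigmaPRel_eq_of_collapse (O : Oracle) {k : ℕ} (hk : SigmaPRel O k = SigmaPRel O (k + 1)) :
    ∀ j : ℕ, k ≤ j → SigmaPRel O j = SigmaPRel O k := by
  intro j hj
  induction hj with
  | refl => rfl
  | step _ ih =>
    show polyExists (co (SigmaPRel O _)) = SigmaPRel O k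
    rw [ih]
    exact hk.symm

/-- **"`PH^O` is infinite" from separating languages at every level**: if for every `k` some
language of `PH^O` lies outside `Σₖ^O`, then no two consecutive levels of `PH^O` coincide
(`IsInfinitePHRel`). [cite: Ko1989, §4.2 (p. 15)] -/
theorem isInfinitePHRel_of_forall_exists {O : Oracle}
    (h : ∀ k : ℕ, ∃ L ∈ PHRel O, L ∉ SigmaPRel O k) : IsInfinitePHRel O := by
  intro k hk
  obtain ⟨L, hL, hLk⟩ := h k
  obtain ⟨j, hj⟩ := Set.mem_iUnion.1 hL
  rcases le_total k j with hkj | hjk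
  · exact hLk (SigmaPRel_eq_of_collapse O hk j hkj ▸ hj)
  · exact hLk (SigmaPRel_mono O hjk hj)

/-! ### The diagonal languages `Sipser_d ∘ OR` of the oracle -/

/-- The hidden bit of block number `i` at level `ℓ`, read through the joined oracle `B`: some
string `1 · p · e` with `p = natBits ℓ i` (the block prefix) and `|e| = ℓ` is in `B` — for
`B = A ⊕ O` this is `g(p) = ⋁_{x ∈ B_{ℓ,p}} O(x)` (Aaronson–Chen's uniform hidden bit).
[cite: AaronsonChen2017, §5.2 (p. 20, "g(p) := ⋁_{x ∈ B_{n,p}} f_n(x)")] -/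
def blockOr (B : Language Bool) (ℓ i : ℕ) : Prop :=
  ∃ e : List Bool, e.length = ℓ ∧ true :: (natBits ℓ i ++ e) ∈ B

/-- Through `A ⊕ O` the hidden bit reads the block-OR of `O`. [cite: AaronsonChen2017, §5.2 (p. 20)] -/
theorem blockOr_oracleJoin_iff (A O : Language Bool) (ℓ i : ℕ) :
    blockOr (oracleJoin A O) ℓ i ↔ ∃ e : List Bool, e.length = ℓ ∧ natBits ℓ i ++ e ∈ O := by
  simp [blockOr]

/-- **The diagonal language `Sipser_d ∘ OR` of the oracle** (the function of Aaronson–Chen's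
Lemma 5.5, one instance per input length): `x ∈ sipserOrLang d B` iff the first component of `x`
is the binary code of a fan-in sequence `ws` of length `d` addressing `∏ ws ≤ 2^{|x|}` blocks of
level `|x|`, and the read-once alternating depth-`d` formula with these fan-ins (root `∨` iff `d`
is even, as for `Sipser_d`) evaluates to true on the hidden bits of those blocks.
[cite: AaronsonChen2017, Lemma 5.5 and proof of the second part of Thm. 5.1 (p. 24)] -/
def sipserOrLang (d : ℕ) (B : Language Bool) : Language Bool :=
  {x | ∃ ws : List ℕ, ws.length = d ∧ (boolUnpair x).1 = encodingListNatBool.encode ws ∧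
    ws.prod ≤ 2 ^ x.length ∧
    sipserEval ws (Nat.bodd d)
      (fun a => @decide (blockOr B x.length (addrIndex ws a)) (Classical.dec _)) = true}

/-- Membership of a canonical input `⟨encode ws, pad⟩`: the fan-ins are `ws` (the code is
injective) and the condition is the formula on the hidden bits of level `|x|`.
[cite: AaronsonChen2017, Lemma 5.5 (p. 24)] -/
theorem boolPair_mem_sipserOrLang_iff {d : ℕ} {ws : List ℕ} (hws : ws.length = d)
    (pad : List Bool) (B : Language Bool) :
    boolPair (encodingListNatBool.encode ws) pad ∈ sipserOrLang d B ↔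
      ws.prod ≤ 2 ^ (boolPair (encodingListNatBool.encode ws) pad).length ∧
      sipserEval ws (Nat.bodd d)
        (fun a => @decide (blockOr B (boolPair (encodingListNatBool.encode ws) pad).length
          (addrIndex ws a)) (Classical.dec _)) = true := by
  constructor
  · rintro ⟨ws', -, hcode, hprod, hval⟩
    rw [boolUnpair_boolPair] at hcode
    obtain rfl : ws' = ws := (encodingListNatBool.encode_injective hcode.symm)
    exact ⟨hprod, hval⟩
  · rintro ⟨hprod, hval⟩
    exact ⟨ws, hws, by rw [boolUnpair_boolPair], hprod, hval⟩

/-! ### The two halves of the standard connection, as named facts -/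

/-- **Upper bound (the routine half of the `PH`–`AC⁰` connection): the diagonal languages are in
`PH^B`.** For every `d` and every oracle language `B`, `sipserOrLang d B ∈ PH^B`: decode the
fan-ins `ws` from the input (reject if malformed or if `∏ ws > 2^{|x|}`), guess the `d` child
indices with `d` alternating polynomially bounded quantifiers (root `∃` iff `d` even), compute the
block number `addrIndex ws a`, and decide the hidden bit `blockOr` with one more existential
quantifier over `e ∈ {0,1}^{|x|}` and one oracle query `1 · natBits |x| i · e` — a
`Σ_{d+1}^B ∪ Π_{d+1}^B ⊆ PH^B` predicate ("it is easy to see that it has a polynomial-size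
circuit (in fact, a formula) of depth `d + 1`", Aaronson–Chen; "clearly, `L_A ∈ Σₖ^P(A)`", Ko,
for the analogous Sipser-type oracle languages). In the tree's model (`PHRel`, `PRel`: transcript
oracle algorithms with a `TM2`-computable step function) the discharge is that machine.
[cite: AaronsonChen2017, §5.4 (p. 24, proof of the second part of Thm. 5.1)] [cite: Ko1989, §4.2 (p. 15)] -/
def sipserOrLang_mem_PHRel : Prop :=
  ∀ (d : ℕ) (B : Language Bool), sipserOrLang d B ∈ PHRel (Oracle.ofLanguage B)

/-- **Lower bound (Aaronson–Chen 2017, §5.4: the content of the second part of Thm. 5.1, in the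
tree's models): almost surely the diagonal language of depth `k + 3` escapes `Σₖ`.** For every
`k` and every fixed left oracle `A`, for `𝒟_O`-almost every `O` (`acOracleMeasure`),
`sipserOrLang (k+3) (A ⊕ O) ∉ Σₖ^{A ⊕ O}`. Printed argument: a `Σₖ^{A ⊕ O}` predicate at a fixed
input is a depth-`(k+2)`, size-`2^{poly}` circuit in the oracle bits of one level (Furst–Saxe–
Sipser; the tree's proved `FSS84_phWindowCircuits`), which by Lemma 5.5 (from Thm. 5.4 = RST
Thm. 1 with `d = k + 3`) agrees with `Sipser_d ∘ OR` with probability at most `1/2 + o(1)` over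
that level of `𝒟_O`, independently of the other levels; over infinitely many sparse levels a
fixed predicate is therefore correct with probability `0`, and there are countably many
predicates. To be DISCHARGED from `rossmanServedioTan2015_thm1` and
`rossmanServedioTan2015_w0_asymp` in the sibling lower-bound files.
[cite: AaronsonChen2017, Thm. 5.1 and §5.4 (Lemma 5.5, proof of the second part, p. 24)] -/
def sipserOrLang_ae_not_mem_sigmaPRel : Prop :=
  ∀ (k : ℕ) (A : Language Bool), ∀ᵐ (O : Set (List Bool)) ∂acOracleMeasure,
    sipserOrLang (k + 3) (oracleJoin A O) ∉ SigmaPRel (Oracle.ofLanguage (oracleJoin A O)) k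

/-! ### The assembly (proved) -/

/-- **For every left oracle `A`, `PH^{A ⊕ O}` is infinite for `𝒟_O`-almost every `O`** — from the
two halves: the countably many almost-sure events `sipserOrLang (k+3) (A ⊕ O) ∉ Σₖ^{A ⊕ O}` hold
simultaneously almost surely, each diagonal language is in `PH^{A ⊕ O}`, and a hierarchy missing
a `PH` language at every level has no two equal consecutive levels.
[cite: AaronsonChen2017, Thm. 5.1 (p. 21) and §5.4 (p. 24)] -/
theorem ae_isInfinitePHRel_oracleJoin (hU : sipserOrLang_mem_PHRel)
    (hL : sipserOrLang_ae_not_mem_sigmaPRel) (A : Language Bool) :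
    ∀ᵐ (O : Set (List Bool)) ∂acOracleMeasure,
      IsInfinitePHRel (Oracle.ofLanguage (oracleJoin A O)) := by
  have h : ∀ᵐ (O : Set (List Bool)) ∂acOracleMeasure, ∀ k : ℕ,
      sipserOrLang (k + 3) (oracleJoin A O) ∉ SigmaPRel (Oracle.ofLanguage (oracleJoin A O)) k :=
    ae_all_iff.2 fun k => hL k A
  exact h.mono fun O hO =>
    isInfinitePHRel_of_forall_exists fun k => ⟨_, hU (k + 3) (oracleJoin A O), hO k⟩

/-- **Aaronson–Chen 2017, Thm. 5.1, second half, from its parts**: with `A = TQBF`,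
`PH^{TQBF ⊕ O}` is infinite for `𝒟_O`-almost every `O`. [cite: AaronsonChen2017, Thm. 5.1 (p. 21) and §5.4 (p. 24)] -/
theorem aaronsonChen2017_thm51_ph_of_parts (hU : sipserOrLang_mem_PHRel)
    (hL : sipserOrLang_ae_not_mem_sigmaPRel) : aaronsonChen2017_thm51_ph :=
  ae_isInfinitePHRel_oracleJoin hU hL TQBF

/-- **Cor. 5.2 from the leaves of both halves of Thm. 5.1**: the §5.3 inclusion
`SampBQP^{TQBF,O} ⊆ SampBPP^{TQBF,O}` a.s., the trivial inclusion `SampBPP^A ⊆ SampBQP^A`, and the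
two halves of the standard connection for §5.4. [cite: AaronsonChen2017, Cor. 5.2 (p. 21)] -/
theorem aaronsonChen2017_cor52_of_parts' (h₁ : aaronsonChen2017_thm51_sampBQP_subset)
    (h₂ : SampPRel_subset_SampBQPRel) (hU : sipserOrLang_mem_PHRel)
    (hL : sipserOrLang_ae_not_mem_sigmaPRel) : aaronsonChen2017_cor52 :=
  aaronsonChen2017_cor52_of_parts h₁ h₂ (aaronsonChen2017_thm51_ph_of_parts hU hL)

end Literature.Barriers.QuantumAdvantage

end
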